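import Summits.AtomisticToContinuum.FouriersLaw.Theses.CageBudgetFekete
import Summits.AtomisticToContinuum.FouriersLaw.Theorems.CageBudgetFeketeHeatVarianceCalculus
import Summits.AtomisticToContinuum.FouriersLaw.Theorems.EmbeddedDrudeMourreGreenKuboContinuationBmFlowInvariant
import Literature.MathematicalPhysics.KineticTheory.InfiniteChainShiftInvariantUniqueness

/-!
# `CageBudgetFekete.HeatVarianceCeiling` / Negative (2): the memory kernel is canonical

Support file (`--supports stmt-AtomisticToContinuum-15770`) of the crux disprover of
`Summit.AtomisticToContinuum.FouriersLaw.Theses.CageBudgetFekete.HeatVarianceCeiling`.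

The crux quantifies over ALL shift-invariant DLR states `μ` of `pinnedChain ω₂ lam β γ` at `T` and ALL
dynamics `D` preserving `μ`. Both universal quantifiers are over (essentially) ONE object:

* the shift-invariant DLR state at `T` is unique
  (`OscillatorChain.eq_of_isChainGibbsMeasure_of_isShiftInvariant_pinnedChain`, in tree), and
* `currentCorrelation_eq_of_preservesMeasure` — ANY two dynamics `D₁`, `D₂` preserving it have the SAME
  summed current autocorrelation at every time, `D₁.currentCorrelation μ t = D₂.currentCorrelation μ t`
  (both flows agree `μ`-a.e. at all times with the canonical Buttà–Marchioro flow on `bmGood`, by the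
  landed rigidity theorem `HeatVarianceCalculus.CanonicalRigidity.flow_ae_eq_canonical`), hence the same
  heat variance (`heatVariance_eq_of_preservesMeasure`) and the same absolute-convergence predicate
  (`hasAbsConvergentCorrelation_iff_of_preservesMeasure`).

Consequences recorded for both sides of the crux (no shift covariance, no momentum reversal, no
continuity hypothesis is needed for any of this): a PROOF may establish the ceiling for one convenient
admissible dynamics (e.g. the canonical one, carrier `bmGood`, shift-covariant everywhere, BM light-cone
estimates available) and a DISPROOF may exhibit superlinear heat variance for any one of them — the
memory kernel `C_T` of the arena is a single explicit function of `(ω₂, lam, β, T)`; there is no freedom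
in `(μ, D)` to exploit or to fear. No new definitions.
refuter-cdisprove-stmt-AtomisticToContinuum-15770-0, 2026-08-17.
-/

noncomputable section

namespace Summit.AtomisticToContinuum.FouriersLaw.Theorems.HeatVarianceCeiling.Negative

open MeasureTheory Filter Set Topology
open Literature.MathematicalPhysics.KineticTheory.HeatConduction
open Summit.AtomisticToContinuum.FouriersLaw.Theorems

/-- **Two admissible dynamics agree a.e. at all times.** For `pinnedChain ω₂ lam β γ`
(`ω₂, lam, β > 0`), `T > 0`, a shift-invariant DLR state `μ` and two dynamics `D₁`, `D₂` preserving
`μ`: `μ`-a.e., `D₁.flow t σ = D₂.flow t σ` for all `t` (both coincide with the canonical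
Buttà–Marchioro flow, `flow_ae_eq_canonical`). [folklore] -/
theorem flow_ae_eq_of_preservesMeasure {ω₂ lam β : ℝ} (γ : ℝ) (hω : 0 < ω₂) (hl : 0 < lam)
    (hβ : 0 < β) {T : ℝ} (hT : 0 < T) {μ : Measure ChainConfig}
    (hG : (pinnedChain ω₂ lam β γ).IsChainGibbsMeasure T μ) (hSI : IsShiftInvariant μ)
    (D₁ D₂ : InfiniteChainDynamics (pinnedChain ω₂ lam β γ)) (h₁ : D₁.PreservesMeasure μ)
    (h₂ : D₂.PreservesMeasure μ) :
    ∀ᵐ σ ∂μ, ∀ t : ℝ, D₁.flow t σ = D₂.flow t σ := by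
  obtain ⟨D', hcar, -⟩ :=
    GreenKuboContinuation.TemperatureBlindVitaliHurwitz.exists_bmDynamics_pinnedChain γ hω.le hl hβ
  filter_upwards [HeatVarianceCalculus.CanonicalRigidity.flow_ae_eq_canonical γ hω hl hβ hT hG hSI D₁ D' h₁ hcar,
    HeatVarianceCalculus.CanonicalRigidity.flow_ae_eq_canonical γ hω hl hβ hT hG hSI D₂ D' h₂ hcar]
    with σ hσ₁ hσ₂ t
  rw [hσ₁ t, hσ₂ t]

/-- **The memory kernel is canonical.** Under the same hypotheses every term of the correlation sum,
and hence `C_T(t) = D.currentCorrelation μ t`, is the same for all dynamics preserving `μ`. [folklore] -/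
theorem currentCorrelation_eq_of_preservesMeasure {ω₂ lam β : ℝ} (γ : ℝ) (hω : 0 < ω₂) (hl : 0 < lam)
    (hβ : 0 < β) {T : ℝ} (hT : 0 < T) {μ : Measure ChainConfig}
    (hG : (pinnedChain ω₂ lam β γ).IsChainGibbsMeasure T μ) (hSI : IsShiftInvariant μ)
    (D₁ D₂ : InfiniteChainDynamics (pinnedChain ω₂ lam β γ)) (h₁ : D₁.PreservesMeasure μ)
    (h₂ : D₂.PreservesMeasure μ) (t : ℝ) :
    D₁.currentCorrelation μ t = D₂.currentCorrelation μ t := by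
  unfold InfiniteChainDynamics.currentCorrelation
  refine tsum_congr fun x => integral_congr_ae ?_
  filter_upwards [flow_ae_eq_of_preservesMeasure γ hω hl hβ hT hG hSI D₁ D₂ h₁ h₂] with σ hσ
  rw [hσ t]

/-- The absolute-convergence predicate is likewise the same for all dynamics preserving `μ`. [folklore] -/
theorem hasAbsConvergentCorrelation_iff_of_preservesMeasure {ω₂ lam β : ℝ} (γ : ℝ) (hω : 0 < ω₂)
    (hl : 0 < lam) (hβ : 0 < β) {T : ℝ} (hT : 0 < T) {μ : Measure ChainConfig}
    (hG : (pinnedChain ω₂ lam β γ).IsChainGibbsMeasure T μ) (hSI : IsShiftInvariant μ)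
    (D₁ D₂ : InfiniteChainDynamics (pinnedChain ω₂ lam β γ)) (h₁ : D₁.PreservesMeasure μ)
    (h₂ : D₂.PreservesMeasure μ) (t : ℝ) :
    D₁.HasAbsConvergentCorrelation μ t ↔ D₂.HasAbsConvergentCorrelation μ t := by
  have hae : ∀ x : ℤ, (fun σ => (pinnedChain ω₂ lam β γ).bondCurrentZ σ 0 *
      (pinnedChain ω₂ lam β γ).bondCurrentZ (D₁.flow t σ) x) =ᵐ[μ]
      (fun σ => (pinnedChain ω₂ lam β γ).bondCurrentZ σ 0 *
      (pinnedChain ω₂ lam β γ).bondCurrentZ (D₂.flow t σ) x) := fun x => by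
    filter_upwards [flow_ae_eq_of_preservesMeasure γ hω hl hβ hT hG hSI D₁ D₂ h₁ h₂] with σ hσ
    rw [hσ t]
  unfold InfiniteChainDynamics.HasAbsConvergentCorrelation
  refine and_congr (forall_congr' fun x => integrable_congr (hae x)) ?_
  have : (fun x : ℤ => |∫ σ, (pinnedChain ω₂ lam β γ).bondCurrentZ σ 0 *
      (pinnedChain ω₂ lam β γ).bondCurrentZ (D₁.flow t σ) x ∂μ|) =
      fun x : ℤ => |∫ σ, (pinnedChain ω₂ lam β γ).bondCurrentZ σ 0 *
      (pinnedChain ω₂ lam β γ).bondCurrentZ (D₂.flow t σ) x ∂μ| :=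
    funext fun x => by rw [integral_congr_ae (hae x)]
  rw [this]

/-- **The heat variance is canonical**: same hypotheses, same `V(τ)` for all dynamics preserving `μ`.
[folklore] -/
theorem heatVariance_eq_of_preservesMeasure {ω₂ lam β : ℝ} (γ : ℝ) (hω : 0 < ω₂) (hl : 0 < lam)
    (hβ : 0 < β) {T : ℝ} (hT : 0 < T) {μ : Measure ChainConfig}
    (hG : (pinnedChain ω₂ lam β γ).IsChainGibbsMeasure T μ) (hSI : IsShiftInvariant μ)
    (D₁ D₂ : InfiniteChainDynamics (pinnedChain ω₂ lam β γ)) (h₁ : D₁.PreservesMeasure μ)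
    (h₂ : D₂.PreservesMeasure μ) (τ : ℝ) :
    2 * ∫ s in Set.Ioc (0:ℝ) τ, (τ - s) * D₁.currentCorrelation μ s =
      2 * ∫ s in Set.Ioc (0:ℝ) τ, (τ - s) * D₂.currentCorrelation μ s := by
  simp only [currentCorrelation_eq_of_preservesMeasure γ hω hl hβ hT hG hSI D₁ D₂ h₁ h₂]

/-- **The universal quantifiers of the crux range over one object.** If SOME shift-invariant DLR state
`μ₀` at `T` and SOME dynamics `D₀` preserving it have an eventually linear heat variance, then EVERY
admissible pair `(μ, D)` at the same parameters has it, with the same constants (state uniqueness +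
`heatVariance_eq_of_preservesMeasure`). Contrapositively: a single admissible pair with superlinear
heat variance refutes the crux for all of them. [folklore] -/
theorem ceiling_transfer {ω₂ lam β : ℝ} (γ : ℝ) (hω : 0 < ω₂) (hl : 0 < lam) (hβ : 0 < β)
    {T : ℝ} (hT : 0 < T) {μ₀ μ : Measure ChainConfig}
    (hG₀ : (pinnedChain ω₂ lam β γ).IsChainGibbsMeasure T μ₀) (hSI₀ : IsShiftInvariant μ₀)
    (hG : (pinnedChain ω₂ lam β γ).IsChainGibbsMeasure T μ) (hSI : IsShiftInvariant μ)
    (D₀ D : InfiniteChainDynamics (pinnedChain ω₂ lam β γ)) (h₀ : D₀.PreservesMeasure μ₀)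
    (h : D.PreservesMeasure μ) {B τ₁ : ℝ}
    (hB : ∀ τ : ℝ, τ₁ ≤ τ → 2 * ∫ s in Set.Ioc (0:ℝ) τ, (τ - s) * D₀.currentCorrelation μ₀ s ≤ B * τ) :
    ∀ τ : ℝ, τ₁ ≤ τ → 2 * ∫ s in Set.Ioc (0:ℝ) τ, (τ - s) * D.currentCorrelation μ s ≤ B * τ := by
  have hμ : μ₀ = μ :=
    OscillatorChain.eq_of_isChainGibbsMeasure_of_isShiftInvariant_pinnedChain γ hω hl.le hβ.le hT
      hG₀ hSI₀ hG hSI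
  subst hμ
  intro τ hτ
  rw [← heatVariance_eq_of_preservesMeasure γ hω hl hβ hT hG₀ hSI₀ D₀ D h₀ h τ]
  exact hB τ hτ

end Summit.AtomisticToContinuum.FouriersLaw.Theorems.HeatVarianceCeiling.Negative

end
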